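import Mathlib.NumberTheory.LocalField.Basic
import Mathlib.FieldTheory.KrullTopology
import Mathlib.FieldTheory.IsAlgClosed.AlgebraicClosure
import Mathlib.RingTheory.IntegralClosure.IsIntegralClosure.Basic
import Mathlib.RingTheory.Valuation.AlgebraInstances
import Mathlib.Topology.Algebra.ContinuousMonoidHom
import Mathlib.Topology.Instances.AddCircle.Defs
import Mathlib.LinearAlgebra.TensorProduct.Basic
import Mathlib.GroupTheory.Torsion
import Mathlib.RingTheory.Valuation.Integral
import Mathlib.Algebra.GroupWithZero.NonZeroDivisors
import Literature.AnabelianGeometry.EtaleTheta.Cyclotome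

/-!
# MLF-Galois model data, the `p`-adic logarithm interface, pre-log-shells and cyclotomes

[AbsTopIII] Definition 3.1 (i), (iv), (v); Lemma 3.4.

Statements-first typing (D-0014) of S. Mochizuki, *Topics in absolute anabelian geometry III*,
§3 "Nonarchimedean Log-Frobenius Compatibility" (bib key `MochizukiAbsTopIII2015`; page
locators = pages of the kurims manuscript, lit key `paper:url-5493eb38cbb7`, not the journal
pagination).  This is the first of two files on Definition 3.1; the second
(`MLFGaloisPairs.lean`) types the abstract `T`-pairs `(Π ↷ M)` of Def 3.1 (i)/(ii), their
morphisms and the log-Frobenius operation on pairs, over the model data defined here.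

## What is typed and how

* Def 3.1 (i) p.66 — MODEL DATA, real definitions over Mathlib: an MLF `k` (Mathlib
  `IsNonarchimedeanLocalField k` + `CharZero k` — a characteristic-zero nonarchimedean local field,
  i.e. a finite extension of some `ℚ_p` = the tree's `IsMLF` of `FundamentalExtension.lean`; bundled
  with an algebraic closure in `MLFClosure`), `K = k̄` (`IsAlgClosure k K`), `G_k = Gal(k̄/k)` (Mathlib `K ≃ₐ[k] K`, Krull
  topology), `𝒪_k̄ = integralClosure 𝒪_k k̄` (`integersClosure`), the units `𝒪_k̄^×`
  (`unitSubmonoid`), the non-zero integers `𝒪_k̄^⊳` (`nonzeroIntegers`) and `k̄^×`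
  (Mathlib `nonZeroDivisors K`, `K⁰`) as submonoids of `k̄`, all `G_k`-stable (proved); a topological group
  `Π_k` with a continuous surjection `ε_k : Π_k ↠ G_k` (`ModelMLFGaloisData`).
* The `p`-adic logarithm `log_k̄ : k~ := (𝒪_k̄^×)^pf ⥲ k̄` of Def 3.1 (i) is NOT constructed here:
  it is the HYPOTHESIS STRUCTURE `GaloisPadicLog` (Galois-side, on `𝒪_k̄^×`; distinct from the
  norm-side `PadicLogOnUnits` of `LogShells.lean`, [AbsTopIII] Def 5.4 (iii), seat abc-iut-L4-t3 —
  ruling ζ of the L4 lead: the two are not unified in wave 1) whose fields quote print (homomorphism on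
  `𝒪^×`, `G_k`-equivariant, kernel on `𝒪^×` = torsion, surjective onto `k̄` — the last two say
  exactly that the induced map on the perfection `(𝒪_k̄^×)^pf = 𝒪_k̄^×/μ(k̄)` is bijective,
  `𝒪_k̄^×` being divisible).  The analytic construction (power series) for a general MLF is
  campaign-S work (TRANCHE-T1 P02, [IUTchIV] Prop 1.2 (i) p.10) — TODO-merge abc-iut-S1: when it
  lands, a `GaloisPadicLog` is BUILT from it and nothing below changes.
* Def 3.1 (iv) p.69 — the **pre-log-shell** `log_k̄(𝒪_k^×) ⊆ k ⊆ k̄` (`GaloisPadicLog.preLogShell`; the datum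
  every later log-shell is built from: [AbsTopIII] Def 5.4, [IUTchIII] Def 1.1, LLANA N10),
  proved `G_k`-invariant.
* Def 3.1 (v) p.69 — the cyclotome `μ_Ẑ(M) = Hom(ℚ/ℤ, M) ≅ lim_n Mˣ[n]`, REALISED as the tree's
  `EtaleTheta.cyclotome Mˣ` (one cyclotome object in the tree), and `μ_{ℚ/ℤ}(M) = μ_Ẑ(M) ⊗ ℚ/ℤ`.
* Lemma 3.4 p.74: its α-free algebraic residue, PROVED (`pow_not_mem_unitSubmonoid_of_preserves`);
  the topological content ("`𝒪_k̄^×` is the maximal compact subgroup of `k̄^×`") is NOT typed here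
  (no ind-topology on `k̄^×` in the tree yet).

Deliberately NOT here: the pairs `(Π ↷ M)`, `T ∈ {TF,TCG,TLG,TM,TS,TS⊞}`, MLF-Galois `T`-pairs,
mono-analytic type, morphisms, the log-Frobenius operation on pairs (file `MLFGaloisPairs`);
Def 3.1 (iii) (categories `𝒞^MLF_T`), (vi) (`Anab`, quoting Cor 1.10 — seat abc-iut-L4-t1);
Prop 3.2, 3.3; Remarks 3.1.1–3.1.3.
-/

namespace Literature.AnabelianGeometry.AbsoluteAnabelian

open _root_.Topology
open scoped _root_.ValuativeRel _root_.TensorProduct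

universe u

noncomputable section


/-! ### Definition 3.1 (i): the model data -/

/-- **Def 3.1 (i), model data.**  "Let `k` be an MLF, `k̄` an algebraic closure of `k`,
`G_k := Gal(k̄/k)` … Let `Π_k` be a topological group, equipped with a continuous surjection
`ε_k : Π_k ↠ G_k`."  `K` plays `k̄`, `G_k` is `K ≃ₐ[k] K` with the Krull topology, and the
structure records `Π_k`, `ε_k`.
[cite: MochizukiAbsTopIII2015, Definition 3.1 (i) p.66] -/
structure ModelMLFGaloisData (k : Type u) [Field k] (K : Type u) [Field K] [Algebra k K] :
    Type (u + 1) where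
  /-- The topological group `Π_k`. -/
  Pi : Type u
  [instGroup : Group Pi]
  [instTop : TopologicalSpace Pi]
  [instTopGroup : IsTopologicalGroup Pi]
  /-- The augmentation `ε_k : Π_k → G_k = Gal(k̄/k)`. -/
  aug : Pi →* (K ≃ₐ[k] K)
  continuous_aug : Continuous aug
  aug_surjective : Function.Surjective aug

attribute [instance] ModelMLFGaloisData.instGroup ModelMLFGaloisData.instTop
  ModelMLFGaloisData.instTopGroup

section Model

variable (k : Type u) [Field k] [ValuativeRel k] (K : Type u) [Field K] [Algebra k K]

/-- `𝒪_k̄`: "the ring of integers of `k̄`", typed as the integral closure of `𝒪_k` (Mathlib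
`𝒪[k]`, the valuation integers) in `K = k̄`.
[cite: MochizukiAbsTopIII2015, Definition 3.1 (i) p.66] -/
def integersClosure : Subalgebra 𝒪[k] K := integralClosure 𝒪[k] K

/-- `𝒪_k̄^⊳ ⊆ 𝒪_k̄`: "the multiplicative monoid of non-zero elements" of the ring of integers of
`k̄`, as a submonoid of `k̄`.
[cite: MochizukiAbsTopIII2015, Definition 3.1 (i) p.66] -/
def nonzeroIntegers : Submonoid K where
  carrier := {x | x ∈ integersClosure k K ∧ x ≠ 0}
  one_mem' := ⟨Subalgebra.one_mem _, one_ne_zero⟩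
  mul_mem' := by
    rintro x y ⟨hx, hx0⟩ ⟨hy, hy0⟩
    exact ⟨Subalgebra.mul_mem _ hx hy, mul_ne_zero hx0 hy0⟩

/-- `𝒪_k̄^× ⊆ 𝒪_k̄`: "the group of units" of the ring of integers of `k̄`, as a submonoid of `k̄`
(elements of `𝒪_k̄` with an inverse in `𝒪_k̄`; `0` is excluded since `0 * y = 0 ≠ 1`).
[cite: MochizukiAbsTopIII2015, Definition 3.1 (i) p.66] -/
def unitSubmonoid : Submonoid K where
  carrier := {x | x ∈ integersClosure k K ∧ ∃ y ∈ integersClosure k K, x * y = 1}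
  one_mem' := ⟨Subalgebra.one_mem _, 1, Subalgebra.one_mem _, one_mul 1⟩
  mul_mem' := by
    rintro x y ⟨hx, x', hx', hxx'⟩ ⟨hy, y', hy', hyy'⟩
    refine ⟨Subalgebra.mul_mem _ hx hy, y' * x', Subalgebra.mul_mem _ hy' hx', ?_⟩
    calc x * y * (y' * x') = x * (y * y') * x' := by ring
      _ = 1 := by rw [hyy', mul_one, hxx']

variable {k K}

/-- `𝒪_k̄^× ⊆ 𝒪_k̄^⊳`: a unit of the ring of integers is a non-zero integer.
[cite: MochizukiAbsTopIII2015, Definition 3.1 (i) p.66] -/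
theorem unitSubmonoid_le_nonzeroIntegers : unitSubmonoid k K ≤ nonzeroIntegers k K := by
  rintro x ⟨hx, y, -, hxy⟩
  refine ⟨hx, ?_⟩
  rintro rfl
  exact zero_ne_one ((zero_mul y).symm.trans hxy)

/-- The Galois group `G_k = Gal(k̄/k)` preserves the ring of integers `𝒪_k̄` (an integral
element is mapped to an integral element by a `k`-algebra automorphism).
[cite: MochizukiAbsTopIII2015, Definition 3.1 (i) p.66] -/
theorem smul_mem_integersClosure (σ : K ≃ₐ[k] K) {x : K} (hx : x ∈ integersClosure k K) :
    σ • x ∈ integersClosure k K := by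
  have h : IsIntegral 𝒪[k] x := hx
  exact h.map (σ.toAlgHom.restrictScalars 𝒪[k])

/-- `G_k` preserves `𝒪_k̄^⊳`.
[cite: MochizukiAbsTopIII2015, Definition 3.1 (i) p.66] -/
theorem smul_mem_nonzeroIntegers (σ : K ≃ₐ[k] K) {x : K} (hx : x ∈ nonzeroIntegers k K) :
    σ • x ∈ nonzeroIntegers k K :=
  ⟨smul_mem_integersClosure σ hx.1, by
    simpa [AlgEquiv.smul_def, map_eq_zero_iff _ σ.injective] using hx.2⟩

/-- `G_k` preserves `𝒪_k̄^×`.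
[cite: MochizukiAbsTopIII2015, Definition 3.1 (i) p.66] -/
theorem smul_mem_unitSubmonoid (σ : K ≃ₐ[k] K) {x : K} (hx : x ∈ unitSubmonoid k K) :
    σ • x ∈ unitSubmonoid k K := by
  obtain ⟨hx, y, hy, hxy⟩ := hx
  refine ⟨smul_mem_integersClosure σ hx, σ • y, smul_mem_integersClosure σ hy, ?_⟩
  rw [← smul_mul', hxy, smul_one]

/-- **Def 3.1 (i): the `p`-adic logarithm as a hypothesis structure** (TODO-merge abc-iut-S1).
"The [`p`-adic] logarithm determines a `Π_k`-equivariant isomorphism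
`log_k̄ : k~ := (𝒪_k̄^×)^pf ⥲ k̄` [where 'pf' denotes the perfection] of the topological group `k~`
onto the additive topological group `k̄`."  Fields: a map `log : k̄ → k̄` (only its values on
`𝒪_k̄^×` matter) that is a homomorphism `𝒪_k̄^× → (k̄, +)`, `G_k`-equivariant (hence
`Π_k`-equivariant for any `ε_k : Π_k ↠ G_k`), whose kernel on `𝒪_k̄^×` is the torsion (roots of
unity) and which is surjective — i.e. the induced map `(𝒪_k̄^×)^pf = 𝒪_k̄^×/μ → k̄` is bijective
(`log 1 = 0` follows from `log_mul`).
The analytic normalisation (the usual power series on `1 + 𝔪`) is campaign-S data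
([IUTchIV] Prop 1.2 (i) p.10, TRANCHE-T1 P02) and is deliberately not a field here.  CAVEAT: these
fields do NOT pin `log` down — for any `c ∈ k^×`, `c • log` satisfies them too — so everything built
from a `GaloisPadicLog` (e.g. the pre-log-shell) is canonical only up to `k^×`-scaling until the
structure is instantiated from abc-iut-S1's analytic logarithm.
[cite: MochizukiAbsTopIII2015, Definition 3.1 (i) p.66] -/
structure GaloisPadicLog (k : Type u) [Field k] [ValuativeRel k] (K : Type u) [Field K]
    [Algebra k K] where
  /-- `log_k̄`, as a total function on `k̄` (values off `𝒪_k̄^×` are irrelevant). -/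
  log : K → K
  log_mul : ∀ x ∈ unitSubmonoid k K, ∀ y ∈ unitSubmonoid k K, log (x * y) = log x + log y
  /-- `G_k`-equivariance: `log (σ x) = σ (log x)`. -/
  log_smul : ∀ (σ : K ≃ₐ[k] K), ∀ x ∈ unitSubmonoid k K, log (σ • x) = σ • log x
  /-- The kernel on `𝒪_k̄^×` is exactly the torsion ("pf" kills precisely the roots of unity). -/
  log_eq_zero_iff : ∀ x ∈ unitSubmonoid k K, log x = 0 ↔ ∃ n : ℕ, 0 < n ∧ x ^ n = 1
  /-- `log_k̄` maps `𝒪_k̄^×` ONTO `k̄`. -/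
  log_surjective : ∀ y : K, ∃ x ∈ unitSubmonoid k K, log x = y

end Model

section Nonzero

variable {k : Type u} [Field k] {K : Type u} [Field K] [Algebra k K]

open scoped nonZeroDivisors

/-- `G_k` preserves `k̄^× = k̄ ∖ {0}` (the arithmetic data of type `TLG`; as a submonoid of `k̄` this is
Mathlib's `nonZeroDivisors K`, notation `K⁰`).
[cite: MochizukiAbsTopIII2015, Definition 3.1 (i) p.67] -/
theorem smul_mem_nonZeroDivisors (σ : K ≃ₐ[k] K) {x : K} (hx : x ∈ K⁰) : σ • x ∈ K⁰ :=
  mem_nonZeroDivisors_iff_ne_zero.2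
    (by simpa [AlgEquiv.smul_def, map_eq_zero_iff _ σ.injective] using
      mem_nonZeroDivisors_iff_ne_zero.1 hx)

end Nonzero

/-- The MLF hypotheses on the base field `k` of a model, bundled: `k` is a mixed-characteristic
nonarchimedean local field — Mathlib `IsNonarchimedeanLocalField` + `CharZero` (which supply the
valuation ring `𝒪_k`; equivalent to the tree's field-type predicate `IsMLF k` of
`FundamentalExtension.lean`, [AbsTopI] §0 "finite over some `ℚ_p`", which is therefore not repeated as
a field) — and `K` is an algebraic closure of `k`.
[cite: MochizukiAbsTopIII2015, Definition 3.1 (i) p.66] -/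
structure MLFClosure : Type (u + 1) where
  /-- The MLF `k`. -/
  k : Type u
  [instField : Field k]
  [instVal : ValuativeRel k]
  [instTop : TopologicalSpace k]
  [instLocal : IsNonarchimedeanLocalField k]
  [instChar : CharZero k]
  /-- An algebraic closure `k̄`. -/
  K : Type u
  [instFieldK : Field K]
  [instAlg : Algebra k K]
  [instClosure : IsAlgClosure k K]

attribute [instance] MLFClosure.instField MLFClosure.instVal MLFClosure.instTop
  MLFClosure.instLocal MLFClosure.instChar MLFClosure.instFieldK MLFClosure.instAlg
  MLFClosure.instClosure

/-! ### Definition 3.1 (iv): the log-Frobenius operation and the pre-log-shell -/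

section LogFrobenius

variable {k : Type u} [Field k] [ValuativeRel k] {K : Type u} [Field K] [Algebra k K]

/-- `𝒪_k^× ⊆ 𝒪_k̄^×`: the `G_k`-invariant units, "the image of the subgroup
`𝒪_k^× = (𝒪_k̄^×)^{Π_k} ⊆ 𝒪_k̄^×` of Galois-invariants of `𝒪_k̄^×`" (invariance under `Π_k` via
the surjection `ε_k` equals invariance under `G_k`).
[cite: MochizukiAbsTopIII2015, Definition 3.1 (iv) p.69] -/
def invariantUnits (k : Type u) [Field k] [ValuativeRel k] (K : Type u) [Field K] [Algebra k K] :
    Set K :=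
  {x | x ∈ unitSubmonoid k K ∧ ∀ σ : K ≃ₐ[k] K, σ • x = x}

/-- **Def 3.1 (iv): the pre-log-shell.**  The log-Frobenius operation replaces the field `k̄`
(with its `Π_k`-action) by `k~ := (𝒪_k̄^×)^pf` with the field structure transported along
`log_k̄ : k~ ⥲ k̄`; the Galois-invariant part of `k~` "is equipped with a natural compactum —
i.e., the compact submodule of `k~ = (𝒪_k̄^×)^pf` determined by the image of the subgroup
`𝒪_k^× = (𝒪_k̄^×)^{Π_k}` — which we shall refer to as the pre-log-shell".  Transported to `k̄` by
`log_k̄` (the only coordinates available before S1's analytic log lands) this is the additive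
subgroup generated by `log_k̄(𝒪_k^×) ⊆ k ⊆ k̄` (in fact equal to that image, `log` being a
homomorphism on the group `𝒪_k^×`; canonical only up to the `k^×`-scaling ambiguity of `GaloisPadicLog`).
[cite: MochizukiAbsTopIII2015, Definition 3.1 (iv) p.69] -/
def GaloisPadicLog.preLogShell (L : GaloisPadicLog k K) : AddSubgroup K :=
  AddSubgroup.closure (L.log '' invariantUnits k K)

/-- The pre-log-shell consists of `G_k`-invariant elements of `k̄` (i.e. lies in `k`), by the
equivariance of `log_k̄`.
[cite: MochizukiAbsTopIII2015, Definition 3.1 (iv) p.69] -/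
theorem GaloisPadicLog.smul_eq_self_of_mem_preLogShell (L : GaloisPadicLog k K) {y : K}
    (hy : y ∈ L.preLogShell) (σ : K ≃ₐ[k] K) : σ • y = y := by
  induction hy using AddSubgroup.closure_induction with
  | mem z hz =>
    obtain ⟨x, ⟨hxu, hxinv⟩, rfl⟩ := hz
    rw [← L.log_smul σ x hxu, hxinv σ]
  | zero => exact smul_zero σ
  | add a b _ _ ha hb => rw [smul_add, ha, hb]
  | neg a _ ha => rw [smul_neg, ha]

end LogFrobenius

/-! ### Definition 3.1 (v): cyclotomes -/

/-- **Def 3.1 (v): the cyclotome** `μ_Ẑ(M) := Hom(ℚ/ℤ, M)` of an abelian monoid `M` (for an MLF-Galois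
`T`-pair, `T ∈ {TLG, TCG, TM}`, "isomorphic to `Ẑ`"; a profinite `Π`-module via the action on `M`).
Since `ℚ/ℤ = colim_n (1/n)ℤ/ℤ`, `Hom(ℚ/ℤ, M) = Hom(ℚ/ℤ, Mˣ) ≅ lim_n Mˣ[n]` canonically; we REALISE
`μ_Ẑ(M)` as the tree's inverse-limit cyclotome `Λ(Mˣ)` of `EtaleTheta/Cyclotome.lean` (LANA §6.1), so
that there is one cyclotome object in the tree (its `Π`-action instance
`EtaleTheta.cyclotome.instMulDistribMulAction` applies as soon as `Π` acts on `Mˣ` by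
`MulDistribMulAction`; for group-valued arithmetic data `Mˣ ≃* M`).
[cite: MochizukiAbsTopIII2015, Definition 3.1 (v) p.69] -/
abbrev cyclotome (M : Type u) [CommMonoid M] : Subgroup (ℕ+ → Mˣ) :=
  Literature.AnabelianGeometry.EtaleTheta.cyclotome Mˣ

/-- **Def 3.1 (v)**: `μ_{ℚ/ℤ}(M) := μ_Ẑ(M) ⊗ ℚ/ℤ` (`ℚ/ℤ` = Mathlib `AddCircle (1 : ℚ)`; the cyclotome
written additively for the tensor product over `ℤ`).
[cite: MochizukiAbsTopIII2015, Definition 3.1 (v) p.69] -/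
def cyclotomeQZ (M : Type u) [CommMonoid M] : Type u :=
  Additive (cyclotome M) ⊗[ℤ] AddCircle (1 : ℚ)

/-! ### Lemma 3.4 (algebraic residue, proved) -/

section Lemma34

open scoped nonZeroDivisors

/-- **Around Lemma 3.4** (Topological Distinguishability of Additive and Multiplicative Structures,
p.74: "let `α : k̄^× ⥲ k̄^×` be an automorphism of the topological group `k̄^×` … then
`α^pf((𝒪_k̄^⊳)^pf) ⊄ (𝒪_k̄^×)^pf`").  The lemma's entire topological content is the sentence "`𝒪_k̄^×` is
easily verified to be the maximal compact subgroup of `k̄^×`", whence `α(𝒪_k̄^×) = 𝒪_k̄^×`; that step is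
NOT typed here (the ind-topology of `k̄^×` is not in the tree).  What we state and PROVE is the
remaining algebraic step, for an abstract multiplicative automorphism `α` of `k̄^×` ASSUMED to
preserve `𝒪_k̄^×` (the proof uses only the inclusion `α⁻¹(𝒪_k̄^×) ⊆ 𝒪_k̄^×`): some non-zero integer `x` has no positive power of `α(x)` in `𝒪_k̄^×` (equivalently
`α^pf((𝒪^⊳)^pf) ⊄ (𝒪^×)^pf`, since `y ⊗ 1 ∈ (𝒪^×)^pf` iff `y^n ∈ 𝒪^×` for some `n ≥ 1`).  Proof as
printed: take `x` = the image of `ϖ ∈ k` with `0 < |ϖ| < 1`; if `x^n` were a unit of `𝒪_k̄` then `ϖ^{-n}`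
would be integral over `𝒪_k`, i.e. `|ϖ^{-n}| ≤ 1` — contradiction.
[cite: MochizukiAbsTopIII2015, Lemma 3.4 p.74] -/
theorem pow_not_mem_unitSubmonoid_of_preserves (C : MLFClosure.{u}) (α : (C.K)⁰ ≃* (C.K)⁰)
    (hα : ∀ x : (C.K)⁰, (x : C.K) ∈ unitSubmonoid C.k C.K ↔ ((α x : (C.K)⁰) : C.K) ∈ unitSubmonoid C.k C.K) :
    ∃ x : (C.K)⁰, (x : C.K) ∈ nonzeroIntegers C.k C.K ∧
      ∀ n : ℕ, 0 < n → ((α x : (C.K)⁰) : C.K) ^ n ∉ unitSubmonoid C.k C.K := by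
  obtain ⟨ϖ, hϖ0, hϖ1⟩ := Valuation.IsNontrivial.exists_lt_one (v := ValuativeRel.valuation C.k)
  have hϖint : ϖ ∈ 𝒪[C.k] := le_of_lt hϖ1
  set x : C.K := algebraMap C.k C.K ϖ with hxdef
  have hx0 : x ≠ 0 := by
    rw [hxdef, map_ne_zero_iff _ (algebraMap C.k C.K).injective]; exact hϖ0
  have hxint : x ∈ integersClosure C.k C.K := by
    have : x = algebraMap (𝒪[C.k]) C.K ⟨ϖ, hϖint⟩ := by
      rw [hxdef, IsScalarTower.algebraMap_apply (𝒪[C.k]) C.k C.K]; rfl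
    rw [this]
    exact isIntegral_algebraMap
  have hx0' : x ∈ (C.K)⁰ := mem_nonZeroDivisors_iff_ne_zero.2 hx0
  refine ⟨⟨x, hx0'⟩, ⟨hxint, hx0⟩, fun n hn hunit => ?_⟩
  have hαn : ((α (⟨x, hx0'⟩ ^ n) : (C.K)⁰) : C.K) ∈ unitSubmonoid C.k C.K := by
    rw [map_pow]
    simpa using hunit
  have hxn : ((⟨x, hx0'⟩ ^ n : (C.K)⁰) : C.K) ∈ unitSubmonoid C.k C.K := (hα _).mpr hαn
  simp only [SubmonoidClass.coe_pow] at hxn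
  obtain ⟨-, y, hy, hxy⟩ := hxn
  have hyeq : y = algebraMap C.k C.K (ϖ ^ n)⁻¹ := by
    have : y = (x ^ n)⁻¹ := eq_inv_of_mul_eq_one_right hxy
    rw [this, hxdef, ← map_pow, map_inv₀]
  have hyint : IsIntegral (𝒪[C.k]) ((ϖ ^ n)⁻¹ : C.k) := by
    have hy' : IsIntegral (𝒪[C.k]) y := hy
    rw [hyeq] at hy'
    exact (isIntegral_algHom_iff (IsScalarTower.toAlgHom (𝒪[C.k]) C.k C.K)
      (algebraMap C.k C.K).injective (x := ((ϖ ^ n)⁻¹ : C.k))).mp hy'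
  have hle : ValuativeRel.valuation C.k ((ϖ ^ n)⁻¹) ≤ 1 :=
    ((Valuation.integer.integers (ValuativeRel.valuation C.k)).isIntegral_iff_v_le_one).mp hyint
  have hlt : ValuativeRel.valuation C.k (ϖ ^ n) < 1 := by
    rw [map_pow]; exact pow_lt_one₀ zero_le hϖ1 (Nat.pos_iff_ne_zero.mp hn)
  rw [map_inv₀] at hle
  have hpos : 0 < ValuativeRel.valuation C.k (ϖ ^ n) :=
    (Valuation.pos_iff _).mpr (pow_ne_zero n hϖ0)
  exact absurd hle (not_le.mpr ((one_lt_inv₀ hpos).mpr hlt))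

end Lemma34

end

end Literature.AnabelianGeometry.AbsoluteAnabelian
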